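import Mathlib
import Literature.NumberTheory.LFunctions.WeilExplicit
import HarnessLib

/-!
# Fourier bounds for the B-spline profile of the PART XIX theta witness (D1's `|ĥ(ξ)| ≤ (Σ|cᵢ|/(2π|ξ|))·(m/(2πε|ξ|))^m`)

WEIL column (LADDER-RH, W-P(P2); crux `ThetaCertificateSound`, director's ruling 2026-08-26T00:59Z assigning D1/D2 to this seat).
The profile of handoff-idea-2's PART XIX / cc-s2-6's THETA-CERT §0 is `h = h₀ ⋆ ρ`, `h₀` a two-step function with jumps of total
size `Σ|cᵢ| = 2 + 2α`, `ρ` the density of the mean of `m` uniforms on `[−ε, ε]` = the `m`-fold convolution of the uniform density on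
`[−ε/m, ε/m]` (a B-spline). In Mathlib's convention `𝓕f(ξ) = ∫ e^{−2πiξx} f(x)dx`:
* `norm_fourier_indicatorConst_le` — `‖𝓕(a·1_{[s,t]})(ξ)‖ ≤ ‖a‖/(π|ξ|)`;
* `norm_fourier_unifDensity_le` — `‖𝓕(unif_c)(ξ)‖ ≤ 1/(2πc|ξ|)`; `bsplineDensity c k` = `(k+1)`-fold convolution, `‖𝓕‖ ≤ (1/(2πc|ξ|))^{k+1}`
  (`Real.fourier_mul_convolution_eq`);
* **`norm_fourier_profile_le`** — for `h = h₀ ⋆ bsplineDensity (ε/m) (m−1)` with `h₀ = 1_{[m₀, c₂−ε]} − α·1_{[c₁+ε, m₀]}`: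
  `‖𝓕h(ξ)‖ ≤ ((1 + |α|)/(π|ξ|))·(m/(2πε|ξ|))^m` — the input of `WeilColumnPoissonMajorant.norm_thetaSum_le_inv_mul_tsum` (p414433)
  that yields THETA-CERT's majorant `M(u)` (D1). RH-free; nothing here bears on the truth of RH.
-/

set_option linter.dupNamespace false

noncomputable section

open MeasureTheory Set Complex Filter intervalIntegral
open scoped Real FourierTransform Convolution
open Literature.NumberTheory.LFunctions

namespace Summit.RiemannHypothesis.RiemannHypothesis.Theorems.WeilColumn.ThetaMellin

variable {s t : ℝ}

/-! ## Fourier transform of a constant on an interval -/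

/-- `a · 1_{[s,t]}` as a complex function. -/
def indicatorConst (s t : ℝ) (a : ℂ) : ℝ → ℂ := Set.indicator (Icc s t) fun _ => a

/-- `a·1_{[s,t]}` is integrable. [folklore] -/
theorem integrable_indicatorConst (s t : ℝ) (a : ℂ) : Integrable (indicatorConst s t a) := by
  unfold indicatorConst
  exact (integrable_indicator_iff measurableSet_Icc).2 (continuous_const.integrableOn_Icc)

/-- `𝓕(a·1_{[s,t]})(ξ) = a · ∫_s^t e^{−2πiξx} dx` for `s ≤ t`. [folklore] -/
theorem fourier_indicatorConst (hst : s ≤ t) (a : ℂ) (ξ : ℝ) :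
    𝓕 (indicatorConst s t a) ξ = a * ∫ x in s..t, Complex.exp (↑(-2 * π * x * ξ) * Complex.I) := by
  rw [Real.fourier_real_eq_integral_exp_smul]
  have e : (fun v : ℝ => Complex.exp (↑(-2 * π * v * ξ) * Complex.I) • indicatorConst s t a v) =
      Set.indicator (Icc s t) (fun v : ℝ => a * Complex.exp (↑(-2 * π * v * ξ) * Complex.I)) := by
    funext v
    unfold indicatorConst
    by_cases hv : v ∈ Icc s t
    · rw [indicator_of_mem hv, indicator_of_mem hv, smul_eq_mul, mul_comm]
    · rw [indicator_of_notMem hv, indicator_of_notMem hv, smul_zero]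
  rw [e, MeasureTheory.integral_indicator measurableSet_Icc, integral_Icc_eq_integral_Ioc, ← intervalIntegral.integral_of_le hst,
    intervalIntegral.integral_const_mul]

/-- **`‖𝓕(a·1_{[s,t]})(ξ)‖ ≤ ‖a‖/(π|ξ|)`** for `ξ ≠ 0` (the two boundary exponentials). [folklore] -/
theorem norm_fourier_indicatorConst_le (hst : s ≤ t) (a : ℂ) {ξ : ℝ} (hξ : ξ ≠ 0) :
    ‖𝓕 (indicatorConst s t a) ξ‖ ≤ ‖a‖ / (π * |ξ|) := by
  rw [fourier_indicatorConst hst a ξ]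
  set c : ℂ := ↑(-2 * π * ξ) * Complex.I with hc
  have hc0 : c ≠ 0 := by
    rw [hc]
    refine mul_ne_zero ?_ Complex.I_ne_zero
    have : (-2 * π * ξ : ℝ) ≠ 0 := by
      have hπ : (π : ℝ) ≠ 0 := Real.pi_ne_zero
      simp [hπ, hξ]
    exact_mod_cast this
  have hint : (∫ x in s..t, Complex.exp (↑(-2 * π * x * ξ) * Complex.I)) = ∫ x in s..t, Complex.exp (c * x) := by
    refine intervalIntegral.integral_congr fun x _ => ?_
    simp only [hc]; congr 1; push_cast; ring
  rw [hint, integral_exp_mul_complex hc0, norm_mul, norm_div]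
  have hnc : ‖c‖ = 2 * π * |ξ| := by
    rw [hc, norm_mul, Complex.norm_I, mul_one, Complex.norm_real, Real.norm_eq_abs, abs_mul, abs_mul, abs_neg,
      abs_of_pos Real.pi_pos]; norm_num
  have hnum : ‖Complex.exp (c * t) - Complex.exp (c * s)‖ ≤ 2 := by
    have h1 : ‖Complex.exp (c * t)‖ = 1 := by rw [hc, Complex.norm_exp]; simp
    have h2 : ‖Complex.exp (c * s)‖ = 1 := by rw [hc, Complex.norm_exp]; simp
    calc ‖Complex.exp (c * t) - Complex.exp (c * s)‖ ≤ ‖Complex.exp (c * t)‖ + ‖Complex.exp (c * s)‖ := norm_sub_le _ _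
      _ = 2 := by rw [h1, h2]; norm_num
  rw [hnc]
  have hpos : 0 < 2 * π * |ξ| := by positivity
  calc ‖a‖ * (‖Complex.exp (c * ↑t) - Complex.exp (c * ↑s)‖ / (2 * π * |ξ|)) ≤ ‖a‖ * (2 / (2 * π * |ξ|)) := by
        gcongr
    _ = ‖a‖ / (π * |ξ|) := by field_simp


/-! ## The uniform density and its convolution powers (B-splines) -/

/-- The uniform probability density on `[−c, c]` (as a complex function): `(2c)⁻¹·1_{[−c,c]}`. -/
def unifDensity (c : ℝ) : ℝ → ℂ := indicatorConst (-c) c (((2 * c)⁻¹ : ℝ) : ℂ)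

/-- The uniform density is integrable. [folklore] -/
theorem integrable_unifDensity (c : ℝ) : Integrable (unifDensity c) := integrable_indicatorConst _ _ _

/-- `‖𝓕(unif_c)(ξ)‖ ≤ 1/(2πc|ξ|)` for `c > 0`, `ξ ≠ 0`. [folklore] -/
theorem norm_fourier_unifDensity_le {c : ℝ} (hc : 0 < c) {ξ : ℝ} (hξ : ξ ≠ 0) :
    ‖𝓕 (unifDensity c) ξ‖ ≤ 1 / (2 * π * c * |ξ|) := by
  have h := norm_fourier_indicatorConst_le (s := -c) (t := c) (by linarith) (((2 * c)⁻¹ : ℝ) : ℂ) hξ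
  have hn : ‖(((2 * c)⁻¹ : ℝ) : ℂ)‖ = (2 * c)⁻¹ := by
    rw [Complex.norm_real, Real.norm_of_nonneg (by positivity)]
  rw [unifDensity]
  refine h.trans (le_of_eq ?_)
  rw [hn]
  field_simp

/-- The B-spline densities: `bsplineDensity c k` = the `(k+1)`-fold convolution power of `unif_c` (the density of `U₁ + ⋯ + U_{k+1}`,
`Uᵢ` uniform on `[−c, c]`; with `c = ε/m`, `k + 1 = m` this is the density of the MEAN of `m` uniforms on `[−ε, ε]` used by PART XIX). -/
def bsplineDensity (c : ℝ) : ℕ → ℝ → ℂ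
  | 0 => unifDensity c
  | k + 1 => weilConv (unifDensity c) (bsplineDensity c k)

/-- Every B-spline density is integrable (Young: `L¹ ⋆ L¹ ⊆ L¹`). [folklore] -/
theorem integrable_bsplineDensity (c : ℝ) : ∀ k : ℕ, Integrable (bsplineDensity c k)
  | 0 => integrable_unifDensity c
  | k + 1 => by
      rw [bsplineDensity, weilConv]
      exact (integrable_unifDensity c).integrable_convolution (ContinuousLinearMap.mul ℂ ℂ) (integrable_bsplineDensity c k)

/-- `𝓕(bsplineDensity c k) = (𝓕 unif_c)^{k+1}` (convolution theorem, `Real.fourier_mul_convolution_eq`). [folklore] -/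
theorem fourier_bsplineDensity (c : ℝ) : ∀ (k : ℕ) (ξ : ℝ), 𝓕 (bsplineDensity c k) ξ = (𝓕 (unifDensity c) ξ) ^ (k + 1)
  | 0, ξ => by simp [bsplineDensity]
  | k + 1, ξ => by
      rw [bsplineDensity, weilConv, Real.fourier_mul_convolution_eq (integrable_unifDensity c) (integrable_bsplineDensity c k),
        fourier_bsplineDensity c k ξ]
      ring

/-- **`‖𝓕(bsplineDensity c k)(ξ)‖ ≤ (1/(2πc|ξ|))^{k+1}`** (`c > 0`, `ξ ≠ 0`). [folklore] -/
theorem norm_fourier_bsplineDensity_le {c : ℝ} (hc : 0 < c) (k : ℕ) {ξ : ℝ} (hξ : ξ ≠ 0) :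
    ‖𝓕 (bsplineDensity c k) ξ‖ ≤ (1 / (2 * π * c * |ξ|)) ^ (k + 1) := by
  rw [fourier_bsplineDensity, norm_pow]
  exact pow_le_pow_left₀ (norm_nonneg _) (norm_fourier_unifDensity_le hc hξ) _


/-- The Fourier integrand of an integrable function is integrable (`|e^{−2πiξv}| = 1`). [folklore] -/
theorem integrable_fourierIntegrand {f : ℝ → ℂ} (hf : Integrable f) (ξ : ℝ) :
    Integrable (fun v : ℝ => Complex.exp (↑(-2 * π * v * ξ) * Complex.I) • f v) := by
  refine hf.norm.mono' ?_ (Eventually.of_forall fun v => ?_)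
  · exact ((by fun_prop : Continuous fun v : ℝ => Complex.exp (↑(-2 * π * v * ξ) * Complex.I)).aestronglyMeasurable.smul
      hf.aestronglyMeasurable)
  · rw [norm_smul, Complex.norm_exp]
    simp

/-! ## The profile `h = h₀ ⋆ ρ` and its Fourier bound -/

/-- The two-step function `h₀ = 1_{[m₀, c₂−ε]} − α·1_{[c₁+ε, m₀]}` of PART XIX (`α = (c₂−ε−m₀)/(m₀−c₁−ε)` makes `∫ h₀ = 0`). -/
def stepProfile (c₁ m₀ c₂ ε α : ℝ) : ℝ → ℂ :=
  indicatorConst m₀ (c₂ - ε) 1 - indicatorConst (c₁ + ε) m₀ (α : ℂ)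

/-- The step profile is integrable. [folklore] -/
theorem integrable_stepProfile (c₁ m₀ c₂ ε α : ℝ) : Integrable (stepProfile c₁ m₀ c₂ ε α) :=
  (integrable_indicatorConst _ _ _).sub (integrable_indicatorConst _ _ _)

/-- `‖𝓕h₀(ξ)‖ ≤ (1 + |α|)/(π|ξ|)` (`= Σ|cᵢ|/(2π|ξ|)` with `Σ|cᵢ| = 2 + 2α` for `α ≥ 0`). [folklore] -/
theorem norm_fourier_stepProfile_le {c₁ m₀ c₂ ε α : ℝ} (h1 : m₀ ≤ c₂ - ε) (h2 : c₁ + ε ≤ m₀) {ξ : ℝ} (hξ : ξ ≠ 0) :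
    ‖𝓕 (stepProfile c₁ m₀ c₂ ε α) ξ‖ ≤ (1 + |α|) / (π * |ξ|) := by
  have hsub : 𝓕 (stepProfile c₁ m₀ c₂ ε α) ξ =
      𝓕 (indicatorConst m₀ (c₂ - ε) 1) ξ - 𝓕 (indicatorConst (c₁ + ε) m₀ (α : ℂ)) ξ := by
    rw [stepProfile, Real.fourier_real_eq_integral_exp_smul, Real.fourier_real_eq_integral_exp_smul,
      Real.fourier_real_eq_integral_exp_smul,
      ← MeasureTheory.integral_sub (integrable_fourierIntegrand (integrable_indicatorConst _ _ _) ξ)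
        (integrable_fourierIntegrand (integrable_indicatorConst _ _ _) ξ)]
    refine integral_congr_ae (Eventually.of_forall fun v => ?_)
    simp only [Pi.sub_apply, smul_sub]
  rw [hsub]
  have hA := norm_fourier_indicatorConst_le h1 (1 : ℂ) hξ
  have hB := norm_fourier_indicatorConst_le h2 (α : ℂ) hξ
  rw [norm_one] at hA
  rw [Complex.norm_real, Real.norm_eq_abs] at hB
  calc ‖𝓕 (indicatorConst m₀ (c₂ - ε) 1) ξ - 𝓕 (indicatorConst (c₁ + ε) m₀ (α : ℂ)) ξ‖
      ≤ ‖𝓕 (indicatorConst m₀ (c₂ - ε) 1) ξ‖ + ‖𝓕 (indicatorConst (c₁ + ε) m₀ (α : ℂ)) ξ‖ := norm_sub_le _ _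
    _ ≤ 1 / (π * |ξ|) + |α| / (π * |ξ|) := add_le_add hA hB
    _ = (1 + |α|) / (π * |ξ|) := by ring

/-- The PART XIX profile: `h = h₀ ⋆ ρ_ε`, `ρ_ε = bsplineDensity (ε/m) (m−1)` (mean of `m` uniforms on `[−ε, ε]`). -/
def profile (c₁ m₀ c₂ ε α : ℝ) (m : ℕ) : ℝ → ℂ :=
  weilConv (stepProfile c₁ m₀ c₂ ε α) (bsplineDensity (ε / m) (m - 1))

/-- **THE FOURIER BOUND OF THE PROFILE (D1's input):** for `m ≥ 1`, `ε > 0`, `c₁ + ε ≤ m₀ ≤ c₂ − ε` and `ξ ≠ 0`,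
`‖𝓕h(ξ)‖ ≤ ((1 + |α|)/(π|ξ|)) · (m/(2πε|ξ|))^m`. [this seat, THETA-KERNEL-BLUEPRINT §5 / THETA-CERT-cc6 §D1] -/
theorem norm_fourier_profile_le {c₁ m₀ c₂ ε α : ℝ} {m : ℕ} (hm : 1 ≤ m) (hε : 0 < ε) (h1 : m₀ ≤ c₂ - ε)
    (h2 : c₁ + ε ≤ m₀) {ξ : ℝ} (hξ : ξ ≠ 0) :
    ‖𝓕 (profile c₁ m₀ c₂ ε α m) ξ‖ ≤ (1 + |α|) / (π * |ξ|) * (m / (2 * π * ε * |ξ|)) ^ m := by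
  have hc : 0 < ε / m := by positivity
  rw [profile, weilConv, Real.fourier_mul_convolution_eq (integrable_stepProfile _ _ _ _ _) (integrable_bsplineDensity _ _),
    norm_mul]
  have hk : m - 1 + 1 = m := Nat.sub_add_cancel hm
  have hB := norm_fourier_bsplineDensity_le hc (m - 1) hξ
  rw [hk] at hB
  have hB' : ‖𝓕 (bsplineDensity (ε / m) (m - 1)) ξ‖ ≤ (m / (2 * π * ε * |ξ|)) ^ m := by
    refine hB.trans (le_of_eq ?_)
    congr 1
    have hm' : (0 : ℝ) < m := by exact_mod_cast hm
    field_simp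
  exact mul_le_mul (norm_fourier_stepProfile_le h1 h2 hξ) hB' (norm_nonneg _) (by positivity)


/-! ## From a `|ξ|^{−(p+1)}` Fourier decay to the lattice sum of `WeilColumnPoissonMajorant` -/

/-- **Lattice-sum bound from polynomial Fourier decay.** If `‖F ξ‖ ≤ C/|ξ|^{p+1}` for `ξ ≠ 0` (`p ≥ 1`, `C ≥ 0`) and `F 0 = 0`
(zero mean; `p ≥ 1`), then for `u > 0` the sequence `n ↦ ‖F(n/u)‖` (`n ∈ ℤ`) is summable and
`Σ_{n ∈ ℤ} ‖F(n/u)‖ ≤ 2·C·u^{p+1}·Σ_{n ≥ 1} n^{−(p+1)}` — with `F = 𝓕G` this is the right-hand side of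
`WeilColumnPoissonMajorant.norm_thetaSum_le_inv_mul_tsum` (p414433), giving THETA-CERT's `|Θ(u)| ≤ M(u)` once
`C = (1+|α|)m^m λ^{−m}/(π(2πε)^m)` is read off `norm_fourier_profile_le` (`𝓕(h(·/λ))(ξ) = λ·𝓕h(λξ)`, `fourier_comp_mul`). [folklore] -/
theorem summable_tsum_norm_le_of_decay {F : ℝ → ℂ} {C : ℝ} {p : ℕ} (hp : 1 ≤ p)
    (hF : ∀ ξ : ℝ, ξ ≠ 0 → ‖F ξ‖ ≤ C / |ξ| ^ (p + 1)) (hF0 : F 0 = 0) {u : ℝ} (hu : 0 < u) :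
    Summable (fun n : ℤ => ‖F (n / u)‖) ∧
      ∑' n : ℤ, ‖F (n / u)‖ ≤ 2 * C * u ^ (p + 1) * ∑' n : ℕ, 1 / ((n : ℝ) + 1) ^ (p + 1) := by
  set a : ℤ → ℝ := fun n => ‖F (n / u)‖ with ha
  set b : ℕ → ℝ := fun n => C * u ^ (p + 1) * (1 / ((n : ℝ) + 1) ^ (p + 1)) with hb
  -- the comparison sequence is summable (p-series, exponent p+1 ≥ 2)
  have hbs : Summable b := by
    have h1 : Summable (fun n : ℕ => 1 / (n : ℝ) ^ (p + 1)) := Real.summable_one_div_nat_pow.mpr (by omega)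
    have h2 : Summable (fun n : ℕ => 1 / ((n : ℝ) + 1) ^ (p + 1)) := by
      have := (summable_nat_add_iff 1).mpr h1
      refine this.congr fun n => ?_
      push_cast; ring_nf
    exact h2.mul_left _
  -- termwise bounds on both halves
  have hpos : ∀ n : ℕ, (0 : ℝ) < (n : ℝ) + 1 := fun n => by positivity
  have key : ∀ n : ℕ, ‖F ((((n : ℤ) + 1 : ℤ) : ℝ) / u)‖ ≤ b n ∧ ‖F (((-((n : ℤ) + 1) : ℤ) : ℝ) / u)‖ ≤ b n := by
    intro n
    have hx : (((n : ℤ) + 1 : ℤ) : ℝ) / u ≠ 0 := by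
      have : (((n : ℤ) + 1 : ℤ) : ℝ) = (n : ℝ) + 1 := by push_cast; ring
      rw [this]; exact div_ne_zero (hpos n).ne' hu.ne'
    have hx' : (((-((n : ℤ) + 1) : ℤ)) : ℝ) / u ≠ 0 := by
      have : (((-((n : ℤ) + 1) : ℤ)) : ℝ) = -((n : ℝ) + 1) := by push_cast; ring
      rw [this]; exact div_ne_zero (neg_ne_zero.mpr (hpos n).ne') hu.ne'
    have habs : ∀ x : ℝ, |x| = (n : ℝ) + 1 → ‖F (x / u)‖ ≤ C / |x / u| ^ (p + 1) → ‖F (x / u)‖ ≤ b n := by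
      intro x hxabs hle
      refine hle.trans (le_of_eq ?_)
      rw [abs_div, abs_of_pos hu, hxabs, hb]
      simp only
      rw [div_pow]
      field_simp
    constructor
    · exact habs _ (by push_cast; rw [abs_of_pos (hpos n)]) (hF _ hx)
    · exact habs _ (by push_cast; rw [abs_neg, abs_of_pos (hpos n)]) (hF _ hx')
  have ha0 : a 0 = 0 := by simp [ha, hF0]
  have hanonneg : ∀ n, 0 ≤ a n := fun n => norm_nonneg _
  -- summability of the two ℕ-halves
  have hs1 : Summable fun n : ℕ => a ((n : ℤ) + 1) :=
    Summable.of_nonneg_of_le (fun n => hanonneg _) (fun n => (key n).1) hbs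
  have hs1' : Summable fun n : ℕ => a n := by
    rw [← summable_nat_add_iff 1]
    refine hs1.congr fun n => ?_
    push_cast; rfl
  have hs2 : Summable fun n : ℕ => a (-((n : ℤ) + 1)) :=
    Summable.of_nonneg_of_le (fun n => hanonneg _) (fun n => (key n).2) hbs
  have hsum : Summable a := Summable.of_nat_of_neg_add_one hs1' hs2
  refine ⟨hsum, ?_⟩
  rw [tsum_of_nat_of_neg_add_one hs1' hs2, Summable.tsum_eq_zero_add hs1']
  have e0 : a ((0 : ℕ) : ℤ) = 0 := by simpa using ha0
  rw [e0, zero_add]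
  have t1 : ∑' n : ℕ, a (((n + 1 : ℕ) : ℤ)) ≤ ∑' n : ℕ, b n :=
    Summable.tsum_le_tsum (fun n => by
        have h := (key n).1
        simp only [ha]
        push_cast at h ⊢
        exact h)
      (by refine hs1.congr fun n => ?_; push_cast; rfl) hbs
  have t2 : ∑' n : ℕ, a (-((n : ℤ) + 1)) ≤ ∑' n : ℕ, b n := Summable.tsum_le_tsum (fun n => (key n).2) hs2 hbs
  have tb : ∑' n : ℕ, b n = C * u ^ (p + 1) * ∑' n : ℕ, 1 / ((n : ℝ) + 1) ^ (p + 1) := by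
    rw [hb]; exact tsum_mul_left
  linarith


/-! ## Supports: the profile vanishes off `[c₁, c₂]` -/

/-- `support (a·1_{[s,t]}) ⊆ [s, t]`. [folklore] -/
theorem support_indicatorConst_subset (s t : ℝ) (a : ℂ) : Function.support (indicatorConst s t a) ⊆ Icc s t := by
  unfold indicatorConst; exact Set.support_indicator_subset

/-- `support (bsplineDensity c k) ⊆ [−(k+1)c, (k+1)c]` for `c ≥ 0`. [folklore] -/
theorem support_bsplineDensity_subset {c : ℝ} (hc : 0 ≤ c) :
    ∀ k : ℕ, Function.support (bsplineDensity c k) ⊆ Icc (-(((k : ℝ) + 1) * c)) (((k : ℝ) + 1) * c)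
  | 0 => by
      have h := support_indicatorConst_subset (-c) c (((2 * c)⁻¹ : ℝ) : ℂ)
      have e : Icc (-(((0 : ℕ) : ℝ) + 1) * c) ((((0 : ℕ) : ℝ) + 1) * c) = Icc (-c) c := by simp
      rw [bsplineDensity, unifDensity]
      intro x hx
      have := h hx
      simp only [Nat.cast_zero, zero_add, one_mul]
      exact this
  | k + 1 => by
      have hu : Function.support (unifDensity c) ⊆ Icc (-c) c := by
        rw [unifDensity]; exact support_indicatorConst_subset (-c) c _
      rw [bsplineDensity, weilConv]
      refine (support_convolution_subset (ContinuousLinearMap.mul ℂ ℂ)).trans ?_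
      refine (Set.add_subset_add hu (support_bsplineDensity_subset hc k)).trans ?_
      rw [Set.Icc_add_Icc (by linarith) (by nlinarith)]
      push_cast
      refine Icc_subset_Icc (by nlinarith) (by nlinarith)

/-- **The profile vanishes off `[c₁, c₂]`**: `support (profile …) ⊆ [c₁, c₂]` (`ε ≥ 0`, `m ≥ 1`, `c₁ + ε ≤ m₀ ≤ c₂ − ε`);
in particular `profile … y = 0` for `y ≤ 0` when `c₁ > 0` — the hypothesis `hneg` of `WeilColumnPoissonMajorant`. [folklore] -/
theorem support_profile_subset {c₁ m₀ c₂ ε α : ℝ} {m : ℕ} (hm : 1 ≤ m) (hε : 0 ≤ ε) (h1 : m₀ ≤ c₂ - ε) (h2 : c₁ + ε ≤ m₀) :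
    Function.support (profile c₁ m₀ c₂ ε α m) ⊆ Icc c₁ c₂ := by
  have hm' : (0 : ℝ) < m := by exact_mod_cast hm
  have hstep : Function.support (stepProfile c₁ m₀ c₂ ε α) ⊆ Icc (c₁ + ε) (c₂ - ε) := by
    intro y hy
    rw [Function.mem_support, stepProfile, Pi.sub_apply] at hy
    by_contra hout
    apply hy
    have hy1 : y ∉ Icc m₀ (c₂ - ε) := fun h => hout ⟨by linarith [h.1], h.2⟩
    have hy2 : y ∉ Icc (c₁ + ε) m₀ := fun h => hout ⟨h.1, by linarith [h.2]⟩
    simp [indicatorConst, indicator_of_notMem hy1, indicator_of_notMem hy2]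
  have hb := support_bsplineDensity_subset (c := ε / m) (by positivity) (m - 1)
  have hk : (((m - 1 : ℕ) : ℝ) + 1) * (ε / m) = ε := by
    rw [Nat.cast_sub hm]; push_cast; field_simp; ring
  rw [hk] at hb
  rw [profile, weilConv]
  refine (support_convolution_subset (ContinuousLinearMap.mul ℂ ℂ)).trans ?_
  refine (Set.add_subset_add hstep hb).trans ?_
  rw [Set.Icc_add_Icc (by linarith) (by linarith)]
  exact Icc_subset_Icc (by linarith) (by linarith)

/-- Hence the profile vanishes on `(−∞, 0]` when `0 < c₁`. [folklore] -/
theorem profile_eq_zero_of_nonpos {c₁ m₀ c₂ ε α : ℝ} {m : ℕ} (hm : 1 ≤ m) (hε : 0 ≤ ε) (h1 : m₀ ≤ c₂ - ε)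
    (h2 : c₁ + ε ≤ m₀) (hc₁ : 0 < c₁) {y : ℝ} (hy : y ≤ 0) : profile c₁ m₀ c₂ ε α m y = 0 := by
  by_contra h
  have := support_profile_subset hm hε h1 h2 (Function.mem_support.mpr h)
  linarith [this.1]


/-- The profile has compact support (inside `[c₁, c₂]`). [folklore] -/
theorem hasCompactSupport_profile {c₁ m₀ c₂ ε α : ℝ} {m : ℕ} (hm : 1 ≤ m) (hε : 0 ≤ ε) (h1 : m₀ ≤ c₂ - ε)
    (h2 : c₁ + ε ≤ m₀) : HasCompactSupport (profile c₁ m₀ c₂ ε α m) :=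
  HasCompactSupport.intro isCompact_Icc fun _ hx =>
    Function.notMem_support.mp fun h => hx (support_profile_subset hm hε h1 h2 h)

/-! ## Zero mean: `∫ h = 0` by the choice of `α` -/

/-- `∫ a·1_{[s,t]} = (t − s)·a` for `s ≤ t`. [folklore] -/
theorem integral_indicatorConst (hst : s ≤ t) (a : ℂ) : ∫ x, indicatorConst s t a x = ((t - s : ℝ) : ℂ) * a := by
  unfold indicatorConst
  rw [MeasureTheory.integral_indicator measurableSet_Icc, setIntegral_const, Real.volume_real_Icc_of_le hst, Complex.real_smul]

/-- `∫ (f ⋆ g) = (∫ f)(∫ g)` for the Weil convolution of integrable functions. [folklore; Mathlib `integral_convolution`] -/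
theorem integral_weilConv {f g : ℝ → ℂ} (hf : Integrable f) (hg : Integrable g) :
    ∫ x, weilConv f g x = (∫ x, f x) * ∫ x, g x := by
  rw [weilConv, MeasureTheory.integral_convolution (ContinuousLinearMap.mul ℂ ℂ) hf hg]
  rfl

/-- **Zero mean of the profile**: with `α = (c₂ − ε − m₀)/(m₀ − c₁ − ε)` (and `c₁ + ε < m₀ ≤ c₂ − ε`), `∫ profile = 0` —
equivalently `𝓕(profile)(0) = 0`, the hypothesis that kills the `n = 0` Poisson term. [folklore] -/
theorem integral_profile_eq_zero {c₁ m₀ c₂ ε α : ℝ} {m : ℕ} (h1 : m₀ ≤ c₂ - ε) (h2 : c₁ + ε < m₀)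
    (hα : α = (c₂ - ε - m₀) / (m₀ - c₁ - ε)) : ∫ x, profile c₁ m₀ c₂ ε α m x = 0 := by
  rw [profile, integral_weilConv (integrable_stepProfile _ _ _ _ _) (integrable_bsplineDensity _ _)]
  have hstep : ∫ x, stepProfile c₁ m₀ c₂ ε α x = 0 := by
    rw [stepProfile]
    change ∫ x, (indicatorConst m₀ (c₂ - ε) 1 x - indicatorConst (c₁ + ε) m₀ (α : ℂ) x) = 0
    rw [MeasureTheory.integral_sub (integrable_indicatorConst _ _ _) (integrable_indicatorConst _ _ _),
      integral_indicatorConst h1, integral_indicatorConst h2.le, mul_one]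
    have hden : m₀ - c₁ - ε ≠ 0 := by linarith
    have hreal : (c₂ - ε - m₀) - (m₀ - (c₁ + ε)) * α = 0 := by
      rw [hα]; field_simp; ring
    have e : ((c₂ - ε - m₀ : ℝ) : ℂ) - ((m₀ - (c₁ + ε) : ℝ) : ℂ) * (α : ℂ) = (((c₂ - ε - m₀) - (m₀ - (c₁ + ε)) * α : ℝ) : ℂ) := by
      push_cast; ring
    rw [e, hreal]
    simp
  rw [hstep, zero_mul]

/-! ## Continuity (inductive step; the base case `unif ⋆ unif` = tent is left to the arithmetic lane) — appended 2026-08-26 -/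

/-- `unif_c ⋆ ρ` is continuous for `ρ` continuous and bounded (Mathlib `BddAbove.continuous_convolution_right_of_integrable`):
the inductive step `bsplineDensity c k` continuous & bounded ⇒ `bsplineDensity c (k+1)` continuous. [folklore] -/
theorem continuous_bsplineDensity_succ {c : ℝ} (k : ℕ) (hcont : Continuous (bsplineDensity c k))
    (hbdd : BddAbove (Set.range fun x => ‖bsplineDensity c k x‖)) : Continuous (bsplineDensity c (k + 1)) := by
  rw [bsplineDensity, weilConv]
  exact hbdd.continuous_convolution_right_of_integrable (ContinuousLinearMap.mul ℂ ℂ) (integrable_unifDensity c) hcont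

/-- The profile `h₀ ⋆ ρ` is continuous as soon as the B-spline density `ρ` is continuous and bounded — the hypothesis `hc` of
`WeilColumnPoissonMajorant.norm_thetaSum_le_inv_mul_tsum`. [folklore] -/
theorem continuous_profile {c₁ m₀ c₂ ε α : ℝ} {m : ℕ} (hcont : Continuous (bsplineDensity (ε / m) (m - 1)))
    (hbdd : BddAbove (Set.range fun x => ‖bsplineDensity (ε / m) (m - 1) x‖)) :
    Continuous (profile c₁ m₀ c₂ ε α m) := by
  rw [profile, weilConv]
  exact hbdd.continuous_convolution_right_of_integrable (ContinuousLinearMap.mul ℂ ℂ) (integrable_stepProfile _ _ _ _ _) hcont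

end Summit.RiemannHypothesis.RiemannHypothesis.Theorems.WeilColumn.ThetaMellin
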